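import Literature.Topology.FourManifolds.CappellShanesonGompfChains
import Mathlib.LinearAlgebra.CrossProduct
import HarnessLib

/-!
# Transposed trace moves are torus twists with a forced intersection number

Companion to `CappellShanesonTranspose.lean` (seat 2 gen 3, staged) and to the bundle note
`papers/sp4-gompf-chains`, Remark [Transposition] / `EXTENSIONS.md` §12 (seat 2 gen 5).

Gompf's Theorem 2.1 (AGT 10 (2010)) realises the trace move `A ↦ Δ^{±1} A` of a Cappell–Shaneson
matrix in standard form (`A e₁ = e₃`, `w = e₁`) by the LINEAR twist `δ = I + b aᵀ` of `T³` along the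
linear torus `a^⊥ ⊇ {w, A w}` in the direction `b = A w - w`, where `a = w × A w` (primitive); in standard
form `a = -e₂`, `b = e₃ - e₁` and `δ = Δ⁻¹`.  Transposing gives `Aᵀ ↦ Aᵀ δᵀ ~ δᵀ Aᵀ` with
`δᵀ = I + a bᵀ`: again a twist, along `b^⊥` in the direction `a` — torus and direction EXCHANGED.
Theorem 2.1 applied to `Aᵀ` yields the twist `δᵀ` only for the circle classes `v = ±(Aᵀ - I)⁻¹ a`, and then
the intersection number of `v` and `Aᵀ v` inside `b^⊥` is `± det (w, A w, A² w) = ± [ℤ³ : ℤ[A] w]`, which is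
`±1` iff `w` is a cyclic vector iff the ideal class of `A` is principal.  The general identity behind this is
`intersection_identity` below (a polynomial identity, proved by `ring`); the rest of this file checks the
instance `(41,189,73)`: `X_{41,189,73}ᵀ ~ Y := X_{83,105,73}` (tree/staged), `Δ⁻¹ Y ~ X_{83,105,-32} ~ A₀`, so
`Σ(X_{41,189,73}) ≅ S⁴` would follow if the single twist `δᵀ = Δ⁻ᵀ` (along `{x₁ = x₃}`, direction `e₂`) preserved
`Σ(Yᵀ)`; the circles Theorem 2.1 would need are `v = (105, 913, 105)`, `Yᵀ v = v + e₂`, meeting `105` times.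
Nothing here is a statement about the spheres.  [cite: GompfAGT2010, Thm 2.1 and §3]

Caveat (verbatim from the bundle README): this file was written by an AI system (research harness seat) and machine-checked by
Lean; it has NOT been independently reviewed by a human expert.  References: R. E. Gompf, *More Cappell–Shaneson spheres are
standard*, Algebr. Geom. Topol. 10 (2010) 1665–1681 (Thm 2.1, §3); M. H. Kim, S. Yamada, *Ideal classes and Cappell–Shaneson homotopy
4-spheres*, J. Gökova Geom. Topol. (2023) (standard matrices `X_{c,d,n}`); K. Iwaki, Topology Appl. 366 (2025) 109293 (the open classes).
-/

-- D-0017 layout `Summit.<Summit>.<Problem>…` repeats the summit name for single-problem summits (gate passes -Dweak.linter.dupNamespace=false under Summits/)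
set_option linter.dupNamespace false

open Literature.Topology.FourManifolds
open scoped MatrixGroups
open Matrix

namespace Summit.SmoothPoincare4.SmoothPoincare4.Theorems.CappellShanesonTransposedTwist

/-! ### 1. The general identity: `a × (Aᵀ a) = -det(w, Aw, A²w) • w` for `a = w × A w` -/

/-- **Intersection identity.** For any `3 × 3` matrix `A` over a commutative ring and any vector `w`, with
`a = w × A w`: `a × (Aᵀ a) = -det(w, A w, A² w) • w`.  (Over `ℤ` with `det A = 1`: the algebraic intersection
number, inside the torus `b^⊥ ∋ w`, of the two circle classes that Theorem 2.1 for `Aᵀ` forces is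
`± det(w, Aw, A²w)`.)  Proof: expand and `ring`. [new] -/
theorem intersection_identity {R : Type*} [CommRing R] (A : Matrix (Fin 3) (Fin 3) R) (w : Fin 3 → R) :
    crossProduct (crossProduct w (A.mulVec w)) (Aᵀ.mulVec (crossProduct w (A.mulVec w)))
      = -(Matrix.of ![w, A.mulVec w, (A * A).mulVec w]).det • w := by
  ext i
  fin_cases i <;>
    simp [cross_apply, Matrix.mulVec, dotProduct, Fin.sum_univ_three, Matrix.det_fin_three,
      Matrix.mul_apply, Matrix.transpose_apply] <;>
    ring

/-- **Adjugate form.** With `a = w × A w` and `b = A w - w`: `(adj(Aᵀ - 1) a) × a = -det(w, A w, A² w) • b`.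
Proof: expand (`Matrix.adjugate_fin_three`) and `ring`. [new] -/
theorem cross_adjugate_identity {R : Type*} [CommRing R] (A : Matrix (Fin 3) (Fin 3) R) (w : Fin 3 → R) :
    crossProduct ((Aᵀ - 1).adjugate.mulVec (crossProduct w (A.mulVec w))) (crossProduct w (A.mulVec w))
      = -(Matrix.of ![w, A.mulVec w, (A * A).mulVec w]).det • (A.mulVec w - w) := by
  ext i
  fin_cases i <;>
    simp [cross_apply, Matrix.mulVec, dotProduct, Fin.sum_univ_three, Matrix.det_fin_three,
      Matrix.adjugate_fin_three, Matrix.mul_apply, Matrix.transpose_apply, Matrix.sub_apply] <;>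
    ring

/-- **Intersection identity, circle form** (the identity quoted in the note's Remark [Transposition]).  If `v` is a
circle class with `(Aᵀ - 1) v = a = w × A w` — for a Cappell–Shaneson matrix `det(Aᵀ - 1) = ±1`, so `v = ±(Aᵀ - 1)⁻¹ a`
exists and is the only candidate — then `det(Aᵀ - 1) • (v × Aᵀ v) = -det(w, A w, A² w) • b`, `b = A w - w`: inside the
`2`-torus `b^⊥` the circles `v` and `Aᵀ v` have algebraic intersection number `± det(w, Aw, A²w) = ± [ℤ³ : ℤ[A] w]`.
Proof: `Aᵀ v = v + a`, `v × v = 0`, `det(Aᵀ - 1) • v = adj(Aᵀ - 1) a`, and `cross_adjugate_identity`. [new] -/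
theorem intersection_identity_circle {R : Type*} [CommRing R] (A : Matrix (Fin 3) (Fin 3) R) (w v : Fin 3 → R)
    (h : (Aᵀ - 1).mulVec v = crossProduct w (A.mulVec w)) :
    (Aᵀ - 1).det • crossProduct v (Aᵀ.mulVec v)
      = -(Matrix.of ![w, A.mulVec w, (A * A).mulVec w]).det • (A.mulVec w - w) := by
  have hv : Aᵀ.mulVec v = v + crossProduct w (A.mulVec w) := by
    have h' := h
    rw [Matrix.sub_mulVec, Matrix.one_mulVec] at h'
    exact sub_eq_iff_eq_add'.mp h'
  have hdet : (Aᵀ - 1).det • v = (Aᵀ - 1).adjugate.mulVec (crossProduct w (A.mulVec w)) := by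
    rw [← h, Matrix.mulVec_mulVec, Matrix.adjugate_mul, Matrix.smul_mulVec, Matrix.one_mulVec]
  rw [hv, map_add, cross_self, zero_add, ← LinearMap.map_smul₂, hdet]
  exact cross_adjugate_identity A w

/-- **For a standard Cappell–Shaneson matrix** `X = X_{c,d,n}` the determinant factor disappears (`det(Xᵀ - 1) = det(X - 1) = 1`,
tree lemma `det_standardCSMatrix_sub_one`): if `(Xᵀ - 1) v = w × X w` then `v × Xᵀ v = -det(w, X w, X² w) • (X w - w)` — the
identity quoted in the note. [new] -/
theorem intersection_identity_standardCSMatrix {c d n : ℤ} (h : d ∣ (csPoly n).eval c) (w v : Fin 3 → ℤ)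
    (hv : ((standardCSMatrix c d n h : Matrix (Fin 3) (Fin 3) ℤ)ᵀ - 1).mulVec v
      = crossProduct w ((standardCSMatrix c d n h : Matrix (Fin 3) (Fin 3) ℤ).mulVec w)) :
    crossProduct v ((standardCSMatrix c d n h : Matrix (Fin 3) (Fin 3) ℤ)ᵀ.mulVec v)
      = -(Matrix.of ![w, (standardCSMatrix c d n h : Matrix (Fin 3) (Fin 3) ℤ).mulVec w,
            ((standardCSMatrix c d n h : Matrix (Fin 3) (Fin 3) ℤ) * (standardCSMatrix c d n h : Matrix (Fin 3) (Fin 3) ℤ)).mulVec w]).det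
        • ((standardCSMatrix c d n h : Matrix (Fin 3) (Fin 3) ℤ).mulVec w - w) := by
  have hdet : (((standardCSMatrix c d n h : Matrix (Fin 3) (Fin 3) ℤ))ᵀ - 1).det = 1 := by
    rw [← Matrix.transpose_one, ← Matrix.transpose_sub, Matrix.det_transpose]
    exact det_standardCSMatrix_sub_one h
  have key := intersection_identity_circle (standardCSMatrix c d n h : Matrix (Fin 3) (Fin 3) ℤ) w v hv
  rwa [hdet, one_smul] at key

/-! ### 2. Gompf's linear twist and its transpose -/

/-- Gompf's linear twist in standard form, `δ = I + b aᵀ` with `a = -e₂`, `b = e₃ - e₁`. [cite: GompfAGT2010, §3 (the matrix Δ)] -/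
def linTwist : Matrix (Fin 3) (Fin 3) ℤ := !![1, 1, 0; 0, 1, 0; 0, -1, 1]

/-- `δ = I + b aᵀ` (`vecMulVec b a = b aᵀ`). [folklore] -/
theorem linTwist_eq : linTwist = 1 + Matrix.vecMulVec ![-1, 0, 1] ![0, -1, 0] := by decide

/-- `δ = Δ⁻¹`: `Δ δ = 1` with the tree's `gompfDelta = !![1,-1,0; 0,1,0; 0,1,1]`. [folklore] -/
theorem gompfDelta_mul_linTwist : (gompfDelta : Matrix (Fin 3) (Fin 3) ℤ) * linTwist = 1 := by
  rw [coe_gompfDelta]; decide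

/-- The transposed twist is `δᵀ = I + a bᵀ`: torus `b^⊥ = {x₁ = x₃}` and direction `a = -e₂` (sign
immaterial) exchanged. [folklore] -/
theorem linTwist_transpose_eq : linTwistᵀ = 1 + Matrix.vecMulVec ![0, -1, 0] ![-1, 0, 1] := by decide

/-! ### 3. The instance `(41,189,73)`: `Y = X_{83,105,73}` -/

/-- `Y = X_{83,105,73} = !![0,-713,-902; 0,83,105; 1,0,-10]`. [folklore] -/
theorem standardCSMatrixVal_83_105_73 :
    standardCSMatrixVal 83 105 73 = !![0, -713, -902; 0, 83, 105; 1, 0, -10] := by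
  simp only [standardCSMatrixVal, csEntryA, eval_csPoly]; decide

/-- `X_{83,105,-32} = !![0,-7519,-9512; 0,83,105; 1,0,-115]`. [folklore] -/
theorem standardCSMatrixVal_83_105_neg32 :
    standardCSMatrixVal 83 105 (-32) = !![0, -7519, -9512; 0, 83, 105; 1, 0, -115] := by
  simp only [standardCSMatrixVal, csEntryA, eval_csPoly]; decide

/-- The trace move `Δ⁻¹ Y`, put back in standard form by the shear `E = !![1,-83,0; 0,1,0; 0,0,1]`,
is `X_{83,105,-32}`: `E (δ Y) E⁻¹ = X_{83,105,-32}`. [folklore] -/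
theorem shear_linTwist_Y :
    !![1, -83, 0; 0, 1, 0; 0, 0, (1 : ℤ)] * (linTwist * !![0, -713, -902; 0, 83, 105; 1, 0, -10])
        * !![1, 83, 0; 0, 1, 0; 0, 0, 1]
      = !![0, -7519, -9512; 0, 83, 105; 1, 0, -115] := by
  decide

/-- The circle class forced on Theorem 2.1 for `Yᵀ` and the twist `δᵀ`: `v = (105, 913, 105)` lies in the
torus `b^⊥ = {x₁ = x₃}` and `Yᵀ v = v + e₂` (so `Yᵀ v - v = e₂ = -a`, the twist direction up to sign). [new] -/
theorem transpose_Y_mulVec_v :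
    (!![0, -713, -902; 0, 83, 105; 1, 0, (-10 : ℤ)])ᵀ.mulVec ![105, 913, 105] = ![105, 914, 105] := by
  decide

/-- `v` is primitive: `gcd(105, 913, 105) = 1` (`913 = 11 · 83`). [folklore] -/
theorem v_primitive : Int.gcd (Int.gcd 105 913) 105 = 1 := by decide

/-- The two circles meet `105` times: `v × Yᵀ v = 105 • b`, `b = e₃ - e₁` the normal of the torus. [new] -/
theorem cross_v_transpose_Y_v :
    crossProduct (![105, 913, 105] : Fin 3 → ℤ) ![105, 914, 105] = (105 : ℤ) • ![-1, 0, 1] := by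
  rw [cross_apply]; decide

/-- … in agreement with the general identity: `det(w, Yw, Y²w) = -105` for `w = e₁`
(`Yw = e₃`, `Y²w = (-902, 105, -10)`), i.e. `[ℤ³ : ℤ[Y] e₁] = 105 = d`. [new] -/
theorem det_krylov_Y : (!![1, 0, 0; 0, 0, 1; -902, 105, (-10 : ℤ)]).det = -105 := by
  simp [Matrix.det_fin_three]

/-- The rows used in `det_krylov_Y` are indeed `w, Yw, Y²w`. [folklore] -/
theorem krylov_rows_Y :
    (!![0, -713, -902; 0, 83, 105; 1, 0, (-10 : ℤ)]).mulVec ![1, 0, 0] = ![0, 0, 1] ∧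
    (!![0, -713, -902; 0, 83, 105; 1, 0, (-10 : ℤ)] * !![0, -713, -902; 0, 83, 105; 1, 0, -10]).mulVec
        ![1, 0, 0] = ![-902, 105, -10] := by
  constructor <;> decide


/-- **The instance is an instance of the general identity.**  For `Y = X_{83,105,73}`, `w = e₁` (`a = e₁ × e₃ = -e₂`) and the
candidate `v' = -(105, 913, 105)` (so that `(Yᵀ - 1) v' = a`), `intersection_identity_standardCSMatrix` gives
`v' × Yᵀ v' = -det(w, Yw, Y²w) • (Y e₁ - e₁) = 105 • (e₃ - e₁)` — the same `105` as the direct computation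
`cross_v_transpose_Y_v`. [new] -/
theorem instance_from_identity (h : (105 : ℤ) ∣ (csPoly 73).eval 83) :
    crossProduct (![-105, -913, -105] : Fin 3 → ℤ)
        ((standardCSMatrix 83 105 73 h : Matrix (Fin 3) (Fin 3) ℤ)ᵀ.mulVec ![-105, -913, -105])
      = (105 : ℤ) • ![-1, 0, 1] := by
  have hY : (standardCSMatrix 83 105 73 h : Matrix (Fin 3) (Fin 3) ℤ) = !![0, -713, -902; 0, 83, 105; 1, 0, -10] := by
    rw [coe_standardCSMatrix]; simp only [csEntryA, eval_csPoly]; decide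
  have key := intersection_identity_standardCSMatrix h ![1, 0, 0] ![-105, -913, -105] (by
    rw [hY, cross_apply]; decide)
  rw [key, hY]
  simp [Matrix.det_fin_three]
  decide

/-- The divisibility making `X_{83,105,73}` a standard matrix: `105 ∣ f₇₃(83) = 74865 = 105 · 713`. [folklore] -/
theorem dvd_83_105_73 : (105 : ℤ) ∣ (csPoly 73).eval 83 := by norm_num [eval_csPoly]

end Summit.SmoothPoincare4.SmoothPoincare4.Theorems.CappellShanesonTransposedTwist
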